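import Literature.NumberTheory.EllipticCurves.VeluNormProofs
import HarnessLib

/-!
# Vélu's numerator explicitly: `U = pXD² - 2f'DD' + 4fD'² - 4fDD'' - T'D²`
# (Blakestad–Grant 2023, Lemma 10 summed over the kernel, point- and divisor-free; proofs only)

Trunk T-NT-EC (Literature/NumberTheory/EllipticCurves). For a finite subgroup `G` without
`2`-torsion (`#G = p = 2n + 1`) of `y² = f(x) = x³ + a₄x + a₆` with kernel polynomial
`D = Π_{±u}(X - x(u))` (`VeluNormProofs.lean`), Blakestad–Grant's Lemma 10,

  `D(D(x - x(u))/(x - x(u))) = 2x - (τ_u^*x + τ_{-u}^*x)`  (`D = d/ω`, `Dx = 2y`, `Dy = f'(x)`),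

summed over the pairs `±u` of the kernel gives (proof of their Prop. 13)
`D(Dφ_ψ(x)/φ_ψ(x)) = px - T(x) = px - x₁ - T'(x)` with Vélu's `x₁ = U/D²` and
`T' = Σ_{u ≠ O} x(u)`. Writing out the second logarithmic derivative
(`D(D log q(x)) = (4f q''q + 2f'q'q - 4f q'²)/q²` for a polynomial `q`), this is the POLYNOMIAL
identity

  **`U = p·X·D² - 2f'·D·D' + 4f·D'² - 4f·D·D'' - T'·D²`**  (`veluU_eq_explicit`),

which we prove directly from Kohel's formula `U = XP₂ + ½Σ_v(t_vX + w_v)Q_v` (no group law, no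
divisors): per point `t_vX + w_v = 2X(X - x_v)² - 2f'(X - x_v) + 4f - 2x_v(X - x_v)²`
(`veluT_mul_X_add_veluWc`, the algebra behind Lemma 10), and the partial-fraction identities of
the kernel polynomial `Σ_{v ≠ O} Q_v(X - x_v) = 2DD'`, `Σ_{v ≠ O} Q_v = 2(D'² - DD'')`
(`sum_veluQ_mul`, `sum_veluQ`; `Q_v = R_{x_v}²`, `D' = Σ_c R_c`, `DD'' = D'² - Σ_c R_c²`).

## Sources

* C. Blakestad, D. Grant, J. Number Theory 249 (2023) (arXiv:1903.02480), Lemma 10 and the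
  proof of Prop. 13 ("sum the formula in Lemma 10 over the orbits of the non-identity elements
  `u` in `G` modulo the action of `[±1]` and add `x` to give `D(Dφ_ψ(x)/φ_ψ(x)) = px - T(x)`").
  [BlakestadGrant2023]
* J. Vélu, C. R. Acad. Sci. Paris 273 (1971) 238–241; D. Kohel, thesis (1996), §2.4. [Velu1971]

Pure proof file; the only new datum is the auxiliary product `veluR` (with body).
-/

noncomputable section

open scoped Classical

namespace WeierstrassCurve.Affine.Point

open Polynomial

/-! ### Partial fractions of the kernel polynomial -/

section Kernel

variable {K : Type*} [Field K] {W : WeierstrassCurve K}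

/-- `(Π_{c ∈ s}(X - c))' = Σ_{c ∈ s} Π_{c' ∈ s ∖ c}(X - c')`. [folklore] -/
theorem derivative_prod_X_sub_C (s : Finset K) :
    derivative (∏ c ∈ s, (X - C c)) = ∑ c ∈ s, ∏ c' ∈ s.erase c, (X - C c') := by
  induction s using Finset.induction_on with
  | empty => simp
  | @insert a s ha ih =>
    rw [Finset.prod_insert ha, derivative_mul, ih, Finset.sum_insert ha, Finset.erase_insert ha, derivative_sub,
      derivative_X, derivative_C, sub_zero, one_mul, Finset.mul_sum]
    congr 1
    refine Finset.sum_congr rfl fun c hc => ?_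
    have hac : a ≠ c := fun h => ha (h ▸ hc)
    rw [Finset.erase_insert_of_ne hac, Finset.prod_insert (fun h => ha (Finset.mem_of_mem_erase h))]

variable (G : Finset W.toAffine.Point)

/-- `R_c = Π_{c' ∈ x(G ∖ O) ∖ c}(X - c')`, so that `D = (X - c)·R_c` and `Q_v = R_{x(v)}²`. [folklore] -/
def veluR (c : K) : K[X] := ∏ c' ∈ (veluXVals G).erase c, (X - C c')

variable {G}

/-- `D = (X - c)·R_c` for `c ∈ x(G ∖ O)`. [folklore] -/
theorem veluD_eq_mul_veluR {c : K} (hc : c ∈ veluXVals G) : veluD G = (X - C c) * veluR G c :=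
  (Finset.mul_prod_erase (veluXVals G) (fun c' => X - C c') hc).symm

/-- **`D' = Σ_c R_c`**. [folklore] -/
theorem derivative_veluD : derivative (veluD G) = ∑ c ∈ veluXVals G, veluR G c := by
  rw [veluD, derivative_prod_X_sub_C]; rfl

/-- **`D·D'' = D'² - Σ_c R_c²`** (`D'' = Σ_c R_c'`, `R_c' = Σ_{c' ≠ c} R_{c,c'}`, `D·R_{c,c'} = R_cR_{c'}`).
[folklore] -/
theorem veluD_mul_derivative_derivative :
    veluD G * derivative (derivative (veluD G)) =
      derivative (veluD G) ^ 2 - ∑ c ∈ veluXVals G, veluR G c ^ 2 := by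
  have hkey : ∀ c ∈ veluXVals G, veluD G * derivative (veluR G c) =
      veluR G c * (derivative (veluD G) - veluR G c) := by
    intro c hc
    have hdR : derivative (veluR G c) =
        ∑ c' ∈ (veluXVals G).erase c, ∏ c'' ∈ ((veluXVals G).erase c).erase c', (X - C c'') :=
      derivative_prod_X_sub_C _
    rw [hdR, Finset.mul_sum, derivative_veluD, ← Finset.sum_erase_eq_sub hc, Finset.mul_sum]
    refine Finset.sum_congr rfl fun c' hc' => ?_
    have hc'x : c' ∈ veluXVals G := Finset.mem_of_mem_erase hc'
    have hcc' : c' ≠ c := Finset.ne_of_mem_erase hc'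
    have hc_in : c ∈ (veluXVals G).erase c' := Finset.mem_erase.mpr ⟨hcc'.symm, hc⟩
    set RR := ∏ c'' ∈ ((veluXVals G).erase c).erase c', (X - C c'') with hRR
    have hRc : veluR G c = (X - C c') * RR :=
      (Finset.mul_prod_erase ((veluXVals G).erase c) (fun c'' => X - C c'') hc').symm
    have hRc' : veluR G c' = (X - C c) * RR := by
      rw [hRR, Finset.erase_right_comm]
      exact (Finset.mul_prod_erase ((veluXVals G).erase c') (fun c'' => X - C c'') hc_in).symm
    rw [veluD_eq_mul_veluR hc, hRc, hRc']
    ring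
  rw [derivative_veluD, derivative_sum, Finset.mul_sum, sq, Finset.sum_mul, ← Finset.sum_sub_distrib]
  refine Finset.sum_congr rfl fun c hc => ?_
  rw [hkey c hc, ← derivative_veluD]
  ring

/-- **`Q_v = R_{x(v)}²`** (both square to `P₂/(X - x(v))²`... precisely `(X - x_v)²Q_v = P₂ = D²`).
[folklore] -/
theorem veluQ_eq_veluR_sq (hG : IsOddSubgroupFinset G) {v : W.toAffine.Point} (hv : v ∈ G.erase 0) :
    veluQ G v = veluR G (xOf v) ^ 2 := by
  have hc : xOf v ∈ veluXVals G := Finset.mem_image_of_mem _ hv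
  have h := sq_mul_veluQ hG hv
  rw [veluP₂_eq_veluD_sq hG, veluD_eq_mul_veluR hc, mul_pow] at h
  exact mul_left_cancel₀ (pow_ne_zero 2 (X_sub_C_ne_zero (xOf v))) h

/-- **Pairing a sum over `G ∖ O` along the fibres of `x`.** [folklore] -/
theorem sum_erase_zero_eq_sum_veluXVals (hG : IsOddSubgroupFinset G) {M : Type*} [AddCommMonoid M]
    (g : W.toAffine.Point → M) (h : K → M) (hgh : ∀ v ∈ G.erase 0, g v + g (-v) = h (xOf v)) :
    ∑ v ∈ G.erase 0, g v = ∑ c ∈ veluXVals G, h c := by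
  rw [← Finset.sum_fiberwise_of_maps_to (s := G.erase 0) (t := veluXVals G) (g := xOf)
    (fun v hv => Finset.mem_image_of_mem _ hv) g]
  refine Finset.sum_congr rfl fun c hc => ?_
  obtain ⟨u, hu, rfl⟩ := Finset.mem_image.mp hc
  rw [filter_xOf_eq hG hu, Finset.sum_pair (hG.neg_ne_self hu).symm]
  exact hgh u hu

/-- **`Σ_{v ≠ O} Q_v·(X - x(v)) = 2DD'`** (`Σ_{v ≠ O} 1/(x - x(v)) = 2D'/D`). [folklore] -/
theorem sum_veluQ_mul (hG : IsOddSubgroupFinset G) :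
    ∑ v ∈ G.erase 0, veluQ G v * (X - C (xOf v)) = 2 * veluD G * derivative (veluD G) := by
  rw [sum_erase_zero_eq_sum_veluXVals hG (fun v => veluQ G v * (X - C (xOf v)))
    (fun c => 2 * (veluR G c ^ 2 * (X - C c))) (fun v hv => by rw [xOf_neg, veluQ_eq_veluR_sq hG hv,
      veluQ_eq_veluR_sq hG (hG.neg_mem_erase hv), xOf_neg, two_mul]),
    ← Finset.mul_sum, derivative_veluD, Finset.mul_sum, Finset.mul_sum]
  refine Finset.sum_congr rfl fun c hc => ?_
  rw [veluD_eq_mul_veluR hc]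
  ring

/-- **`Σ_{v ≠ O} Q_v = 2(D'² - DD'')`** (`Σ_{v ≠ O} 1/(x - x(v))² = -2(D'/D)'`). [folklore] -/
theorem sum_veluQ (hG : IsOddSubgroupFinset G) :
    ∑ v ∈ G.erase 0, veluQ G v = 2 * (derivative (veluD G) ^ 2 - veluD G * derivative (derivative (veluD G))) := by
  rw [sum_erase_zero_eq_sum_veluXVals hG (fun v => veluQ G v) (fun c => 2 * veluR G c ^ 2)
    (fun v hv => by rw [veluQ_eq_veluR_sq hG hv, veluQ_eq_veluR_sq hG (hG.neg_mem_erase hv), xOf_neg, two_mul]),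
    ← Finset.mul_sum, veluD_mul_derivative_derivative]
  ring

end Kernel

/-! ### `U` explicitly -/

section Explicit

variable {K : Type*} [Field K] {W : WeierstrassCurve K} {G : Finset W.toAffine.Point}

/-- **The algebra behind Blakestad–Grant's Lemma 10**: for `v = (x_v, y_v)` on `y² = f(x)`,
`t_vX + w_v = 2X(X - x_v)² - 2f'(X)(X - x_v) + 4f(X) - 2x_v(X - x_v)²`
(`t_v = 6x_v² + 2a₄`, `w_v = -2x_v³ + 2a₄x_v + 4a₆`), i.e.
`(x(P+v) + x(P-v) - 2x_v)(x - x_v)² = 2x(x - x_v)² - D(x - x_v)·... ` — with `Dx = 2y`, `Dy = f'(x)`,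
`2x - D(D(x - x_v)/(x - x_v)) = (2x(x-x_v)² - 2f'(x)(x-x_v) + 4f(x))/(x-x_v)² = x(P+v) + x(P-v)`.
[Blakestad–Grant 2023, Lemma 10] [cite: BlakestadGrant2023, Lemma 10] -/
theorem veluT_mul_X_add_veluWc (v : W.toAffine.Point) :
    C (veluT v) * X + C (veluWc v) = 2 * X * (X - C (xOf v)) ^ 2 - 2 * derivative (veluF W) * (X - C (xOf v)) +
      4 * veluF W - 2 * C (xOf v) * (X - C (xOf v)) ^ 2 := by
  rw [veluT, veluWc, veluF]
  simp only [derivative_mul, derivative_X_pow, derivative_X, derivative_C, map_add, map_mul, map_pow, map_neg,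
    map_ofNat, Nat.cast_ofNat, zero_mul, add_zero, mul_one]
  ring

/-- **Vélu's numerator explicitly**:

  `U = p·X·D² - 2f'·D·D' + 4f·D'² - 4f·D·D'' - T'·D²`,

`p = #G`, `T' = Σ_{v ≠ O} x(v)` — the polynomial form of Blakestad–Grant's
`D(Dφ_ψ(x)/φ_ψ(x)) = px - x₁ - T'(x)` (`x₁ = U/D²`, `φ_ψ = pD`;
`D(D log D(x)) = (2f'DD' - 4fD'² + 4fDD'')/D²`). [Blakestad–Grant 2023, Lemma 10 and proof of
Prop. 13; Vélu 1971] [cite: BlakestadGrant2023, Lemma 10] -/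
theorem veluU_eq_explicit (hG : IsOddSubgroupFinset G) (h2 : (2 : K) ≠ 0) :
    veluU G = C ((G.erase 0).card + 1 : K) * X * veluD G ^ 2
      - 2 * derivative (veluF W) * veluD G * derivative (veluD G)
      + 4 * veluF W * derivative (veluD G) ^ 2
      - 4 * veluF W * veluD G * derivative (derivative (veluD G))
      - C (∑ v ∈ G.erase 0, xOf v) * veluD G ^ 2 := by
  have hP₂ := veluP₂_eq_veluD_sq hG
  -- `Σ_v (X - x_v)² Q_v·g(v) = D²·Σ_v g(v)`
  have hsq : ∀ v ∈ G.erase 0, (X - C (xOf v)) ^ 2 * veluQ G v = veluD G ^ 2 := fun v hv => by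
    rw [sq_mul_veluQ hG hv, hP₂]
  have hU₁ : veluU₁ G = C ((G.erase 0).card : K) * X * veluD G ^ 2
      - 2 * derivative (veluF W) * veluD G * derivative (veluD G)
      + 4 * veluF W * (derivative (veluD G) ^ 2 - veluD G * derivative (derivative (veluD G)))
      - C (∑ v ∈ G.erase 0, xOf v) * veluD G ^ 2 := by
    have hterm : ∀ v ∈ G.erase 0, (C (veluT v) * X + C (veluWc v)) * veluQ G v =
        2 * X * veluD G ^ 2 - 2 * derivative (veluF W) * (veluQ G v * (X - C (xOf v))) + 4 * veluF W * veluQ G v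
          - 2 * C (xOf v) * veluD G ^ 2 := by
      intro v hv
      rw [veluT_mul_X_add_veluWc, ← hsq v hv]
      ring
    rw [veluU₁, Finset.sum_congr rfl hterm, Finset.sum_sub_distrib, Finset.sum_add_distrib, Finset.sum_sub_distrib,
      Finset.sum_const, ← Finset.mul_sum, ← Finset.mul_sum, ← Finset.sum_mul, sum_veluQ_mul hG, sum_veluQ hG,
      nsmul_eq_mul, map_sum]
    have h2C : C (2⁻¹ : K) * 2 = 1 := by rw [show (2 : K[X]) = C 2 from (map_ofNat C 2).symm, ← C_mul, inv_mul_cancel₀ h2, C_1]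
    rw [← Finset.mul_sum, map_natCast]
    linear_combination (↑(G.erase 0).card * X * veluD G ^ 2 - derivative (veluF W) * (veluD G * derivative (veluD G)) * 2
      + 4 * veluF W * (derivative (veluD G) ^ 2 - veluD G * derivative (derivative (veluD G)))
      - (∑ v ∈ G.erase 0, C (xOf v)) * veluD G ^ 2) * h2C
  rw [veluU, hU₁, hP₂, map_add, map_one]
  ring

end Explicit

end WeierstrassCurve.Affine.Point
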